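import Summits.ValiantsHypothesis.ValiantsHypothesis.Theses.ContractivityPrice
import Literature.Computability.AlgebraicComplexity.DeterminantalComplexityProofs

/-!
# ValiantsHypothesis / ContractivityPrice — `StabilisedPerDetRepr` (substitution glue)

Route `ContractivityPrice`, item `stmt-ValiantsHypothesis-10587` (support, rank 9): an affine
determinantal representation of `per_n` of size `m` gives one of the stabilised permanent
`Q_n = per_n(I + z/(4n))`, of the same size `m`.

Proof (Mignon–Ressayre 2004, §1; Bürgisser 2000, §2.5 — determinantal representations are stable
under affine substitution): if `per_n = det A` with `A` an `m × m` matrix of affine linear forms,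
apply the algebra map `x_e ↦ δ_e + x_e/(4n)` (i.e. `MvPolynomial.aeval a` with
`a e = C δ_e + C (4n)⁻¹ * X e`) entrywise. Algebra homomorphisms commute with determinants
(`AlgHom.map_det`), so `det (aeval a ∘ A) = aeval a (det A) = Q_n`; and since every `a e` is affine,
substitution does not raise total degrees
(`Literature.Computability.AlgebraicComplexity.HasDetRepr.totalDegree_aeval_le_of_le_one`), so the
new entries are again affine. Nothing else is here.
-/

namespace Summit.ValiantsHypothesis.Theorems

open MvPolynomial Literature.Computability.AlgebraicComplexity

/-- The stabilising substitution `x_e ↦ δ_e + x_e/(4n)` is affine: each image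
`C δ_e + C (4n)⁻¹ * X e` has total degree `≤ 1`. [folklore] -/
theorem totalDegree_stabilisingSubst_le_one (n : ℕ) (e : Fin n × Fin n) :
    (C (if e.1 = e.2 then (1 : ℂ) else 0) + C ((4 * (n : ℂ))⁻¹) * X e :
      MvPolynomial (Fin n × Fin n) ℂ).totalDegree ≤ 1 := by
  refine (totalDegree_add _ _).trans (max_le ?_ ?_)
  · rw [totalDegree_C]
    exact Nat.zero_le _
  · refine (totalDegree_mul _ _).trans ?_
    rw [totalDegree_C, totalDegree_X, zero_add]

/-- Settles `stmt-ValiantsHypothesis-10587` (`StabilisedPerDetRepr`, route `ContractivityPrice`):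
an affine determinantal representation of `per_n` of size `m` yields one of
`Q_n = per_n(I + z/(4n))` of the same size — substitute `x_e ↦ δ_e + x_e/(4n)` entrywise;
determinants commute with algebra maps (`AlgHom.map_det`) and affine entries stay affine
(`HasDetRepr.totalDegree_aeval_le_of_le_one`). Hence `dc(Q_n) ≤ dc(per_n)`
(Mignon–Ressayre 2004, §1; Bürgisser 2000, §2.5). [folklore] -/
theorem stabilisedPerDetRepr_proof :
    Summit.ValiantsHypothesis.ValiantsHypothesis.Theses.ContractivityPrice.StabilisedPerDetRepr := by
  unfold Summit.ValiantsHypothesis.ValiantsHypothesis.Theses.ContractivityPrice.StabilisedPerDetRepr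
  intro n m h
  obtain ⟨A, hA, hdet⟩ := h
  refine ⟨(aeval fun e : Fin n × Fin n =>
      C (if e.1 = e.2 then (1 : ℂ) else 0) + C ((4 * (n : ℂ))⁻¹) * X e).mapMatrix A,
    fun i j => ?_, ?_⟩
  · rw [AlgHom.mapMatrix_apply, Matrix.map_apply]
    exact (HasDetRepr.totalDegree_aeval_le_of_le_one _
      (totalDegree_stabilisingSubst_le_one n) _).trans (hA i j)
  · rw [← AlgHom.map_det, hdet]

end Summit.ValiantsHypothesis.Theorems
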